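import Literature.MathematicalPhysics.QuantumFieldTheory.Balaban1983to89.T4StabilityFloorUnitary
import Literature.MathematicalPhysics.QuantumFieldTheory.Balaban1983to89.B10Eq71TorusLocal
import HarnessLib

/-!
# TAILSUP₁∘ ∕ FPT · THE CUBE BIANCHI INEQUALITY: one plaquette's action term is at most `5N` times the sum of the other five faces' terms

Definition-free helper for crux `stmt-QuantumFields-20520` (`UnitScaleTilt.FluctuationComparisonRegPrIntL`), cell `ym3-torus` (rung R3 = SU(2) YM₃ on T³ —
NOT d = 4, NOT infinite volume, NOT a mass gap, NOT Clay); width seat `ym-ust-20520-w4` g17 on ★★OWNER WORD 97 «GO» (LEAD-20520 w3 g17's hand-plan v1.2, TAILSUP₁∘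
residue (MOMENT): «ONE first moment of the DELETED plaquette's tilted action under the deleted-weight fibre law»).  THIS FILE gives the DETERMINISTIC half:
the deleted plaquette's term `1 − reTr U(∂p)` is bounded POINTWISE by `5N ×` the sum of the terms of the other five faces of any unit cube containing `p` — so its
first moment under `e^{−β A_{¬p}}·κ_V` is at most `5N ×` the sum of five PRESENT plaquettes' first moments under the same law (where the Jensen∕comparison doors
✓`…TailSupOneDeletedTermJensen`, ✓`…TailSupOneComparisonDoor` speak).  The probabilistic half is NOT here.

* §1 ★ `plaqHol_cube_bianchi` — the NON-ABELIAN CUBE BIANCHI IDENTITY in the tree's conventions (`GaugeField.plaqHol`, `Site.shift`): for `μ < ν < λ` and a cube based at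
  `x`, the bottom face `U(∂(x;μ,ν))` is the product of FIVE factors, each a conjugate of another face's holonomy or of its inverse:
  `U(∂(x;μ,ν)) = S₁ · g₂ S₂ g₂⁻¹ · g₃ S₃⁻¹ g₃⁻¹ · e₀ T e₀⁻¹ · S₄⁻¹` with `S₁ = U(∂(x;μ,λ))`, `S₂ = U(∂(x+e_μ;ν,λ))`, `S₃ = U(∂(x+e_ν;μ,λ))`, `S₄ = U(∂(x;ν,λ))`,
  `T = U(∂(x+e_λ;μ,ν))`, `e₀ = U(x,λ)`, `g₂ = U(x,λ)U(x+e_λ,μ)U(x+e_μ,λ)⁻¹`, `g₃ = U(x,λ)U(x+e_λ,μ)U(x+e_λ+e_μ,ν)U(x+e_λ+e_ν,μ)⁻¹U(x+e_ν,λ)⁻¹` (a word identity, `group`);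
* §2 generic `GaugeGroup` bookkeeping: `dist1` of a product of five; `1 − reTr` is blind to conjugation and inversion;
* §3 ★★ `one_sub_reTr_prod_five_le` — on `SU(N)`: `1 − reTr (c₁c₂c₃c₄c₅) ≤ 5N · Σᵢ (1 − reTr cᵢ)` (✓`one_sub_reTr_le_half_dist1_sq_specialUnitary`, `dist1_mul_le`,
  Cauchy–Schwarz, ✓`dist1_sq_le_specialUnitaryGroup`);
* §4 ★★★ `plaqTerm_bottom_le_cube_faces`, ★★ `plaqTerm_sideMuLam_le_cube_faces`, ★★ `plaqTerm_sideNuLam_le_cube_faces` — for `μ < ν < λ`: the term of the face `(x;μ,ν)`, resp.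
  `(x;μ,λ)`, resp. `(x;ν,λ)`, is `≤ 5N ×` the sum of the other five faces' terms.  In `d = 3` every plaquette `(x; a, b)` is one of these three for the cube at `x`
  (third axis above, between, or below), so the deleted-plaquette moment always reduces to present plaquettes of ONE cube.

HONEST: lattice∕matrix bookkeeping [folklore] (the cube Bianchi identity; [Balaban1985Averaging] (19)–(20) for the `dist1` calculus); the MOMENT bound itself, TAILSUP₁∘, MOD₁∘,
FAR₁∕FPT, LFR♯ᶜ∘, S2β and crux 20520 are NOT proved; no summit is proved by a helper; the Yang–Mills mass gap is NOT proved.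
-/

noncomputable section

open Literature.MathematicalPhysics.QuantumFieldTheory.Balaban1983to89
open Literature.MathematicalPhysics.QuantumFieldTheory.Balaban1983to89.T4StabilityFloorUnitary (one_sub_reTr_le_half_dist1_sq_specialUnitary)
open Literature.MathematicalPhysics.QuantumFieldTheory.Balaban1983to89.B10Eq71TorusLocal (dist1_sq_le_specialUnitaryGroup)

namespace Summit.QuantumFields.YangMills.Theorems.FluctuationComparisonRegPrIntLTailSupOneCubeBianchi

/-! ## §1 The cube Bianchi identity -/

section Identity

variable {P : Params} {j : ℕ} {G : Type*} [GaugeGroup G]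

/-- Lattice shifts commute: `(x + e_a) + e_b = (x + e_b) + e_a`. [folklore] -/
theorem shift_shift_comm (x : Site P j) (a b : Fin P.d) : (x.shift a).shift b = (x.shift b).shift a := by
  funext i
  by_cases ha : i = a <;> by_cases hb : i = b
  · subst ha; subst hb; simp [Site.shift]
  · subst ha; simp [Site.shift, hb]
  · subst hb; simp [Site.shift, ha]
  · simp [Site.shift, ha, hb]

/-- ★ **THE NON-ABELIAN CUBE BIANCHI IDENTITY** (tree conventions `plaqHol U ⟨x, μ, ν⟩ = U(x,μ)U(x+e_μ,ν)U(x+e_ν,μ)⁻¹U(x,ν)⁻¹`): for `μ < ν < λ`, the bottom face of the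
cube at `x` is a product of five conjugates of the other faces (or their inverses). [folklore] -/
theorem plaqHol_cube_bianchi (U : GaugeField P j G) (x : Site P j) {μ ν lam : Fin P.d} (hμν : μ < ν) (hνl : ν < lam) :
    GaugeField.plaqHol U ⟨x, μ, ν, hμν⟩ =
      GaugeField.plaqHol U ⟨x, μ, lam, hμν.trans hνl⟩ *
      ((U ⟨x, lam⟩ * U ⟨x.shift lam, μ⟩ * (U ⟨x.shift μ, lam⟩)⁻¹) * GaugeField.plaqHol U ⟨x.shift μ, ν, lam, hνl⟩ *
        (U ⟨x, lam⟩ * U ⟨x.shift lam, μ⟩ * (U ⟨x.shift μ, lam⟩)⁻¹)⁻¹) *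
      ((U ⟨x, lam⟩ * U ⟨x.shift lam, μ⟩ * U ⟨(x.shift lam).shift μ, ν⟩ * (U ⟨(x.shift lam).shift ν, μ⟩)⁻¹ * (U ⟨x.shift ν, lam⟩)⁻¹) *
        (GaugeField.plaqHol U ⟨x.shift ν, μ, lam, hμν.trans hνl⟩)⁻¹ *
        (U ⟨x, lam⟩ * U ⟨x.shift lam, μ⟩ * U ⟨(x.shift lam).shift μ, ν⟩ * (U ⟨(x.shift lam).shift ν, μ⟩)⁻¹ * (U ⟨x.shift ν, lam⟩)⁻¹)⁻¹) *
      (U ⟨x, lam⟩ * GaugeField.plaqHol U ⟨x.shift lam, μ, ν, hμν⟩ * (U ⟨x, lam⟩)⁻¹) *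
      (GaugeField.plaqHol U ⟨x, ν, lam, hνl⟩)⁻¹ := by
  simp only [GaugeField.plaqHol]
  rw [shift_shift_comm x μ lam, shift_shift_comm x ν lam, shift_shift_comm x μ ν]
  group

end Identity

/-! ## §2 Generic `GaugeGroup` bookkeeping -/

section Generic

variable {G : Type*} [GaugeGroup G]

/-- `1 − reTr` is blind to conjugation. [cite: Balaban1985Averaging, (19) p.21] -/
theorem one_sub_reTr_conj (g h : G) : 1 - reTr (h * g * h⁻¹) = 1 - reTr g := by
  rw [GaugeGroup.reTr_conj]

/-- `1 − reTr` is blind to inversion. [cite: Balaban1985Averaging, (19) p.21] -/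
theorem one_sub_reTr_inv (g : G) : 1 - reTr g⁻¹ = 1 - reTr g := by
  rw [GaugeGroup.reTr_inv]

/-- `dist1` of a product of five. [cite: Balaban1985Averaging, (20) p.21] -/
theorem dist1_mul_five_le (c₁ c₂ c₃ c₄ c₅ : G) :
    dist1 (c₁ * c₂ * c₃ * c₄ * c₅) ≤ dist1 c₁ + dist1 c₂ + dist1 c₃ + dist1 c₄ + dist1 c₅ := by
  have h4 := GaugeGroup.dist1_mul_le (c₁ * c₂ * c₃ * c₄) c₅
  have h3 := GaugeGroup.dist1_mul_le (c₁ * c₂ * c₃) c₄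
  have h2 := GaugeGroup.dist1_mul_le (c₁ * c₂) c₃
  have h1 := GaugeGroup.dist1_mul_le c₁ c₂
  linarith

end Generic

/-! ## §3 On `SU(N)`: the term of a product of five is at most `5N` times the sum of the terms -/

section SUN

variable {N : ℕ} [NeZero N]

/-- ★★ **PRODUCT-OF-FIVE BOUND ON `SU(N)`**: `1 − reTr (c₁c₂c₃c₄c₅) ≤ 5N · Σᵢ (1 − reTr cᵢ)` (`1 − reTr V ≤ ½ dist1 V²`, the `dist1` triangle inequality, Cauchy–Schwarz
for five terms, `dist1 W² ≤ 2N (1 − reTr W)`). [cite: Balaban1985Averaging, (19)-(20) p.21] -/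
theorem one_sub_reTr_prod_five_le (c₁ c₂ c₃ c₄ c₅ : Matrix.specialUnitaryGroup (Fin N) ℂ) :
    1 - reTr (c₁ * c₂ * c₃ * c₄ * c₅) ≤
      5 * (N : ℝ) * ((1 - reTr c₁) + (1 - reTr c₂) + (1 - reTr c₃) + (1 - reTr c₄) + (1 - reTr c₅)) := by
  have hprod := one_sub_reTr_le_half_dist1_sq_specialUnitary (c₁ * c₂ * c₃ * c₄ * c₅)
  have htri := dist1_mul_five_le c₁ c₂ c₃ c₄ c₅
  have h1 := dist1_sq_le_specialUnitaryGroup c₁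
  have h2 := dist1_sq_le_specialUnitaryGroup c₂
  have h3 := dist1_sq_le_specialUnitaryGroup c₃
  have h4 := dist1_sq_le_specialUnitaryGroup c₄
  have h5 := dist1_sq_le_specialUnitaryGroup c₅
  have d0 := GaugeGroup.dist1_nonneg (c₁ * c₂ * c₃ * c₄ * c₅)
  have d1 := GaugeGroup.dist1_nonneg c₁
  have d2 := GaugeGroup.dist1_nonneg c₂
  have d3 := GaugeGroup.dist1_nonneg c₃
  have d4 := GaugeGroup.dist1_nonneg c₄
  have d5 := GaugeGroup.dist1_nonneg c₅
  -- Cauchy–Schwarz for five nonnegative reals: `(Σ tᵢ)² ≤ 5 Σ tᵢ²`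
  have hcs : (dist1 c₁ + dist1 c₂ + dist1 c₃ + dist1 c₄ + dist1 c₅) ^ 2 ≤
      5 * (dist1 c₁ ^ 2 + dist1 c₂ ^ 2 + dist1 c₃ ^ 2 + dist1 c₄ ^ 2 + dist1 c₅ ^ 2) := by
    nlinarith [sq_nonneg (dist1 c₁ - dist1 c₂), sq_nonneg (dist1 c₁ - dist1 c₃), sq_nonneg (dist1 c₁ - dist1 c₄), sq_nonneg (dist1 c₁ - dist1 c₅),
      sq_nonneg (dist1 c₂ - dist1 c₃), sq_nonneg (dist1 c₂ - dist1 c₄), sq_nonneg (dist1 c₂ - dist1 c₅), sq_nonneg (dist1 c₃ - dist1 c₄),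
      sq_nonneg (dist1 c₃ - dist1 c₅), sq_nonneg (dist1 c₄ - dist1 c₅)]
  have hsq : dist1 (c₁ * c₂ * c₃ * c₄ * c₅) ^ 2 ≤ (dist1 c₁ + dist1 c₂ + dist1 c₃ + dist1 c₄ + dist1 c₅) ^ 2 :=
    pow_le_pow_left₀ d0 htri 2
  have hN : (0 : ℝ) ≤ N := Nat.cast_nonneg N
  nlinarith

/-- The same with each factor replaced by a CONJUGATE of a group element or of its inverse — the shape the cube identity produces (`1 − reTr` is blind to both).
[cite: Balaban1985Averaging, (19)-(20) p.21] -/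
theorem one_sub_reTr_prod_five_conj_le (c₁ c₂ c₃ c₄ c₅ s₁ s₂ s₃ s₄ s₅ : Matrix.specialUnitaryGroup (Fin N) ℂ)
    (h₁ : 1 - reTr c₁ = 1 - reTr s₁) (h₂ : 1 - reTr c₂ = 1 - reTr s₂) (h₃ : 1 - reTr c₃ = 1 - reTr s₃) (h₄ : 1 - reTr c₄ = 1 - reTr s₄)
    (h₅ : 1 - reTr c₅ = 1 - reTr s₅) :
    1 - reTr (c₁ * c₂ * c₃ * c₄ * c₅) ≤
      5 * (N : ℝ) * ((1 - reTr s₁) + (1 - reTr s₂) + (1 - reTr s₃) + (1 - reTr s₄) + (1 - reTr s₅)) := by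
  rw [← h₁, ← h₂, ← h₃, ← h₄, ← h₅]
  exact one_sub_reTr_prod_five_le c₁ c₂ c₃ c₄ c₅

end SUN

/-! ## §4 The cube bounds for `SU(N)` lattice gauge fields -/

section Cube

variable {P : Params} {j : ℕ} {N : ℕ} [NeZero N]

/-- ★★★ **BOTTOM FACE**: for `μ < ν < λ`, `1 − reTr U(∂(x;μ,ν)) ≤ 5N · [ (x;μ,λ) + (x+e_μ;ν,λ) + (x+e_ν;μ,λ) + (x+e_λ;μ,ν) + (x;ν,λ) ]` (terms `1 − reTr U(∂·)`).
[cite: Balaban1985Averaging, (19)-(20) p.21] -/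
theorem plaqTerm_bottom_le_cube_faces (U : GaugeField P j (Matrix.specialUnitaryGroup (Fin N) ℂ)) (x : Site P j) {μ ν lam : Fin P.d}
    (hμν : μ < ν) (hνl : ν < lam) :
    1 - reTr (GaugeField.plaqHol U ⟨x, μ, ν, hμν⟩) ≤
      5 * (N : ℝ) * ((1 - reTr (GaugeField.plaqHol U ⟨x, μ, lam, hμν.trans hνl⟩)) +
        (1 - reTr (GaugeField.plaqHol U ⟨x.shift μ, ν, lam, hνl⟩)) +
        (1 - reTr (GaugeField.plaqHol U ⟨x.shift ν, μ, lam, hμν.trans hνl⟩)) +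
        (1 - reTr (GaugeField.plaqHol U ⟨x.shift lam, μ, ν, hμν⟩)) +
        (1 - reTr (GaugeField.plaqHol U ⟨x, ν, lam, hνl⟩))) := by
  rw [plaqHol_cube_bianchi U x hμν hνl]
  refine one_sub_reTr_prod_five_conj_le _ _ _ _ _ _ _ _ _ _ rfl ?_ ?_ ?_ ?_
  · exact one_sub_reTr_conj _ _
  · rw [one_sub_reTr_conj, one_sub_reTr_inv]
  · exact one_sub_reTr_conj _ _
  · exact one_sub_reTr_inv _

/-- ★★ **SIDE FACE `(x;μ,λ)`** (`μ < ν < λ`): solving the cube identity for `S₁` — `S₁ = P₀ · S₄ · (e₀Te₀⁻¹)⁻¹ · (g₃S₃⁻¹g₃⁻¹)⁻¹ · (g₂S₂g₂⁻¹)⁻¹` — gives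
`1 − reTr U(∂(x;μ,λ)) ≤ 5N · [ (x;μ,ν) + (x;ν,λ) + (x+e_λ;μ,ν) + (x+e_ν;μ,λ) + (x+e_μ;ν,λ) ]`. [cite: Balaban1985Averaging, (19)-(20) p.21] -/
theorem plaqTerm_sideMuLam_le_cube_faces (U : GaugeField P j (Matrix.specialUnitaryGroup (Fin N) ℂ)) (x : Site P j) {μ ν lam : Fin P.d}
    (hμν : μ < ν) (hνl : ν < lam) :
    1 - reTr (GaugeField.plaqHol U ⟨x, μ, lam, hμν.trans hνl⟩) ≤
      5 * (N : ℝ) * ((1 - reTr (GaugeField.plaqHol U ⟨x, μ, ν, hμν⟩)) +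
        (1 - reTr (GaugeField.plaqHol U ⟨x, ν, lam, hνl⟩)) +
        (1 - reTr (GaugeField.plaqHol U ⟨x.shift lam, μ, ν, hμν⟩)) +
        (1 - reTr (GaugeField.plaqHol U ⟨x.shift ν, μ, lam, hμν.trans hνl⟩)) +
        (1 - reTr (GaugeField.plaqHol U ⟨x.shift μ, ν, lam, hνl⟩))) := by
  -- abbreviations
  set P₀ := GaugeField.plaqHol U ⟨x, μ, ν, hμν⟩ with hP₀
  set S₁ := GaugeField.plaqHol U ⟨x, μ, lam, hμν.trans hνl⟩ with hS₁
  set S₂ := GaugeField.plaqHol U ⟨x.shift μ, ν, lam, hνl⟩ with hS₂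
  set S₃ := GaugeField.plaqHol U ⟨x.shift ν, μ, lam, hμν.trans hνl⟩ with hS₃
  set S₄ := GaugeField.plaqHol U ⟨x, ν, lam, hνl⟩ with hS₄
  set T := GaugeField.plaqHol U ⟨x.shift lam, μ, ν, hμν⟩ with hT
  set g₂ := U ⟨x, lam⟩ * U ⟨x.shift lam, μ⟩ * (U ⟨x.shift μ, lam⟩)⁻¹ with hg₂
  set g₃ := U ⟨x, lam⟩ * U ⟨x.shift lam, μ⟩ * U ⟨(x.shift lam).shift μ, ν⟩ * (U ⟨(x.shift lam).shift ν, μ⟩)⁻¹ * (U ⟨x.shift ν, lam⟩)⁻¹ with hg₃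
  set e₀ := U ⟨x, lam⟩ with he₀
  have hB : P₀ = S₁ * (g₂ * S₂ * g₂⁻¹) * (g₃ * S₃⁻¹ * g₃⁻¹) * (e₀ * T * e₀⁻¹) * S₄⁻¹ := plaqHol_cube_bianchi U x hμν hνl
  have hS : S₁ = P₀ * S₄ * (e₀ * T⁻¹ * e₀⁻¹) * (g₃ * S₃ * g₃⁻¹) * (g₂ * S₂⁻¹ * g₂⁻¹) := by
    rw [hB]; group
  rw [hS]
  refine one_sub_reTr_prod_five_conj_le _ _ _ _ _ _ _ _ _ _ rfl rfl ?_ ?_ ?_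
  · rw [one_sub_reTr_conj, one_sub_reTr_inv]
  · exact one_sub_reTr_conj _ _
  · rw [one_sub_reTr_conj, one_sub_reTr_inv]

/-- ★★ **SIDE FACE `(x;ν,λ)`** (`μ < ν < λ`): solving the cube identity for `S₄` — `S₄ = P₀⁻¹ · S₁ · (g₂S₂g₂⁻¹) · (g₃S₃⁻¹g₃⁻¹) · (e₀Te₀⁻¹)` — gives
`1 − reTr U(∂(x;ν,λ)) ≤ 5N · [ (x;μ,ν) + (x;μ,λ) + (x+e_μ;ν,λ) + (x+e_ν;μ,λ) + (x+e_λ;μ,ν) ]`. [cite: Balaban1985Averaging, (19)-(20) p.21] -/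
theorem plaqTerm_sideNuLam_le_cube_faces (U : GaugeField P j (Matrix.specialUnitaryGroup (Fin N) ℂ)) (x : Site P j) {μ ν lam : Fin P.d}
    (hμν : μ < ν) (hνl : ν < lam) :
    1 - reTr (GaugeField.plaqHol U ⟨x, ν, lam, hνl⟩) ≤
      5 * (N : ℝ) * ((1 - reTr (GaugeField.plaqHol U ⟨x, μ, ν, hμν⟩)) +
        (1 - reTr (GaugeField.plaqHol U ⟨x, μ, lam, hμν.trans hνl⟩)) +
        (1 - reTr (GaugeField.plaqHol U ⟨x.shift μ, ν, lam, hνl⟩)) +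
        (1 - reTr (GaugeField.plaqHol U ⟨x.shift ν, μ, lam, hμν.trans hνl⟩)) +
        (1 - reTr (GaugeField.plaqHol U ⟨x.shift lam, μ, ν, hμν⟩))) := by
  set P₀ := GaugeField.plaqHol U ⟨x, μ, ν, hμν⟩ with hP₀
  set S₁ := GaugeField.plaqHol U ⟨x, μ, lam, hμν.trans hνl⟩ with hS₁
  set S₂ := GaugeField.plaqHol U ⟨x.shift μ, ν, lam, hνl⟩ with hS₂
  set S₃ := GaugeField.plaqHol U ⟨x.shift ν, μ, lam, hμν.trans hνl⟩ with hS₃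
  set S₄ := GaugeField.plaqHol U ⟨x, ν, lam, hνl⟩ with hS₄
  set T := GaugeField.plaqHol U ⟨x.shift lam, μ, ν, hμν⟩ with hT
  set g₂ := U ⟨x, lam⟩ * U ⟨x.shift lam, μ⟩ * (U ⟨x.shift μ, lam⟩)⁻¹ with hg₂
  set g₃ := U ⟨x, lam⟩ * U ⟨x.shift lam, μ⟩ * U ⟨(x.shift lam).shift μ, ν⟩ * (U ⟨(x.shift lam).shift ν, μ⟩)⁻¹ * (U ⟨x.shift ν, lam⟩)⁻¹ with hg₃
  set e₀ := U ⟨x, lam⟩ with he₀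
  have hB : P₀ = S₁ * (g₂ * S₂ * g₂⁻¹) * (g₃ * S₃⁻¹ * g₃⁻¹) * (e₀ * T * e₀⁻¹) * S₄⁻¹ := plaqHol_cube_bianchi U x hμν hνl
  have hS : S₄ = P₀⁻¹ * S₁ * (g₂ * S₂ * g₂⁻¹) * (g₃ * S₃⁻¹ * g₃⁻¹) * (e₀ * T * e₀⁻¹) := by
    rw [hB]; group
  rw [hS]
  refine one_sub_reTr_prod_five_conj_le _ _ _ _ _ _ _ _ _ _ ?_ rfl ?_ ?_ ?_
  · exact one_sub_reTr_inv _
  · exact one_sub_reTr_conj _ _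
  · rw [one_sub_reTr_conj, one_sub_reTr_inv]
  · exact one_sub_reTr_conj _ _

end Cube

end Summit.QuantumFields.YangMills.Theorems.FluctuationComparisonRegPrIntLTailSupOneCubeBianchi

end
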